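/-
Copyright: the b2b-balaban T⁴-continuum CRUX team, row NE7b OWNER lineage `t4-ne7b-p1` (gen 145). Project licence.
-/
import Mathlib

/-!
# THE `K4`-FAMILY PROFILE LETTERS OF THE WEIGHTED CLASS (SCOPING-d17 §D F1 at order 4; (659) extended).  The weighted fourth-order slot
# letters (662)–(665) take four profile letters of the step's `K4`-family `g^{abc}_{z′} = Σ_u|A_{uz′}|K4_{abcu}`: the masses with the fixed index
# in position 1, 2, 3 and partner weights, `Σ_{p,q}ϑ₂(s,p)ϑ₂(s,q)ϑ₂(p,q)Σ_{z′}g_{z′}σ_{sz′} ≤ αk4m1∕2∕3`, and the column letter with internal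
# weights `Σ_{a,b,c}g^{abc}_{z′}σ_{az′}ϑ₂(a,b)ϑ₂(a,c)ϑ₂(b,c) ≤ αk4c`.  THIS FILE discharges them from the CLASS's intrinsic full-graph
# `ϑ₂`-letters of `K4` (`Σ_{p,q,u}K4·Π_{6 pairs}ϑ₂` in the four roles, `k4ϑ1..k4ϑ4`) and the FACTOR's weighted letters (`Σ_{z′}|A_{uz′}|σA_{uz′}
# ≤ αrσ`, `Σ_u|A_{uz′}|σA_{uz′} ≤ αcσ`) under the compatibility `σ_{vz′} ≤ ϑ₂(v,u)·σA_{uz′}` ((651)∕(659)):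
#   `αk4m_i = k4ϑ_i·αrσ` (i = 1,2,3), `αk4c = k4ϑ4·αcσ`
# (row NE7b, node U5c; Mathlib only; [folklore]).  With (659) this closes the letter supply of (662)–(665): the weighted class map at order
# 4 needs only the factor's weighted letters and the class's own `ϑ₂`-letters.

Cell `pub-balaban`, sub-cell `t4`, spine estimate NE7b (`T4WeightBudget.RelWeightBound`; the cell's OWN estimate — NOT PRINTED in
[Bałaban 1983–89], NOT PROVED).  Crux-route work under `Spine/NE7b/` by the row OWNER (`t4-ne7b-p1` gen 145, file (666)) under FREEZE
(0)'s crux-prover clause; NOTHING of Bałaban's is named as a Lean object, valued or asserted; no `T4Continuum/Support` leaf typed; no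
`def`, no notation; zero `sorry`.  Imports: Mathlib only.

WHAT IS PROVED ([folklore]): **`k4_mass_1`**, **`k4_mass_2`**, **`k4_mass_3`** (`αk4m·`), **`k4_col_internal`** (`αk4c`); toy.

HONEST (what this is NOT).  Letter transport only (the `u`-innermost letter shapes used here differ from (663)'s `hk4` shape by a
reindexing and `ϑ₂`-symmetry — bookkeeping for the (d14)(3) packaging); scalar skeleton ((A3), NC-NE7b-α UNRULED); nothing of Bałaban's
asserted.  BY-NAME EFFECT ON THE WALL: NONE.  NE7b NOT PRINTED ∕ NOT PROVED; spine PROVED 0∕9; rung (B)+1 — the programme's measures remain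
FINITE-torus statements; NOT the mass gap, NOT Clay.  HONEST DEPENDENCY: continuum YM on T⁴ ⇐ BetaPertH ∧ nine spine estimates (0∕9
proved); BetaPertH ⇐ (D1) ∧ (D4) ∧ CAP+tail; G-an2-4 gates asym, D1 and NE2∕3∕4.
-/

set_option autoImplicit false

noncomputable section

namespace Summit.QuantumFields.BalabanUV.T4Continuum.NE7b.SupWeightedFamilyProfilesK4

open Finset Real Matrix
open scoped BigOperators

variable {ι κ : Type} [Fintype ι] [Fintype κ]

variable {A : Matrix ι κ ℝ} {K4 : ι → ι → ι → ι → ℝ} {ϑ₂ : ι → ι → ℝ} {σ σA : ι → κ → ℝ} {αrσ αcσ k4ϑ1 k4ϑ2 k4ϑ3 k4ϑ4 : ℝ}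

/-! ## The three masses -/

/-- **`αk4m1`**: the `K4`-family mass with the fixed index in position 1 and partner weights,
`Σ_{p,q}ϑ₂(s,p)ϑ₂(s,q)ϑ₂(p,q)Σ_{z′}(Σ_u|A_{uz′}|K4)σ_{sz′} ≤ k4ϑ1·αrσ` from the full-graph letter of that role. [folklore] -/
theorem k4_mass_1 (hK40 : ∀ a b c u, 0 ≤ K4 a b c u) (hϑ₂1 : ∀ x y, 1 ≤ ϑ₂ x y) (hσA0 : ∀ u z', 0 ≤ σA u z')
    (hσϑ : ∀ v u z', σ v z' ≤ ϑ₂ v u * σA u z') (hAr : ∀ u, ∑ z', |A u z'| * σA u z' ≤ αrσ) (hα0 : 0 ≤ αrσ)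
    (hk4 : ∀ s, ∑ p, ∑ q, ∑ u, K4 s p q u * (ϑ₂ s p * ϑ₂ s q * ϑ₂ s u * ϑ₂ p q * ϑ₂ p u * ϑ₂ q u) ≤ k4ϑ1) (s : ι) :
    ∑ p, ∑ q, (ϑ₂ s p * ϑ₂ s q * ϑ₂ p q) * ∑ z', (∑ u, |A u z'| * K4 s p q u) * σ s z' ≤ k4ϑ1 * αrσ := by
  have hϑ₂0 : ∀ x y, 0 ≤ ϑ₂ x y := fun x y => zero_le_one.trans (hϑ₂1 x y)
  have hW0 : ∀ p q u, 0 ≤ ϑ₂ s p * ϑ₂ s q * ϑ₂ s u * ϑ₂ p q * ϑ₂ p u * ϑ₂ q u := fun p q u =>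
    mul_nonneg (mul_nonneg (mul_nonneg (mul_nonneg (mul_nonneg (hϑ₂0 s p) (hϑ₂0 s q)) (hϑ₂0 s u)) (hϑ₂0 p q)) (hϑ₂0 p u)) (hϑ₂0 q u)
  calc ∑ p, ∑ q, (ϑ₂ s p * ϑ₂ s q * ϑ₂ p q) * ∑ z', (∑ u, |A u z'| * K4 s p q u) * σ s z'
      ≤ ∑ p, ∑ q, ∑ u, K4 s p q u * (ϑ₂ s p * ϑ₂ s q * ϑ₂ s u * ϑ₂ p q * ϑ₂ p u * ϑ₂ q u) * ∑ z', |A u z'| * σA u z' := by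
        refine sum_le_sum fun p _ => sum_le_sum fun q _ => ?_
        rw [mul_sum]
        calc ∑ z', (ϑ₂ s p * ϑ₂ s q * ϑ₂ p q) * ((∑ u, |A u z'| * K4 s p q u) * σ s z')
            ≤ ∑ z', ∑ u, K4 s p q u * (ϑ₂ s p * ϑ₂ s q * ϑ₂ s u * ϑ₂ p q * ϑ₂ p u * ϑ₂ q u) * (|A u z'| * σA u z') := by
              refine sum_le_sum fun z' _ => ?_
              rw [sum_mul, mul_sum]
              refine sum_le_sum fun u _ => ?_
              calc (ϑ₂ s p * ϑ₂ s q * ϑ₂ p q) * (|A u z'| * K4 s p q u * σ s z') ≤ (ϑ₂ s p * ϑ₂ s q * ϑ₂ p q) * (|A u z'| * K4 s p q u * (ϑ₂ s u *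
        σA u z')) :=
                    mul_le_mul_of_nonneg_left (mul_le_mul_of_nonneg_left (hσϑ s u z') (mul_nonneg (abs_nonneg _) (hK40 _ _ _ _)))
                      (mul_nonneg (mul_nonneg (hϑ₂0 s p) (hϑ₂0 s q)) (hϑ₂0 p q))
                _ = K4 s p q u * (ϑ₂ s p * ϑ₂ s q * ϑ₂ s u * ϑ₂ p q * 1 * 1) * (|A u z'| * σA u z') := by ring
                _ ≤ K4 s p q u * (ϑ₂ s p * ϑ₂ s q * ϑ₂ s u * ϑ₂ p q * ϑ₂ p u * ϑ₂ q u) * (|A u z'| * σA u z') :=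
                    mul_le_mul_of_nonneg_right (mul_le_mul_of_nonneg_left (mul_le_mul (mul_le_mul_of_nonneg_left (hϑ₂1 p u)
                      (mul_nonneg (mul_nonneg (mul_nonneg (hϑ₂0 s p) (hϑ₂0 s q)) (hϑ₂0 s u)) (hϑ₂0 p q))) (hϑ₂1 q u) zero_le_one
                      (mul_nonneg (mul_nonneg (mul_nonneg (mul_nonneg (hϑ₂0 s p) (hϑ₂0 s q)) (hϑ₂0 s u)) (hϑ₂0 p q)) (hϑ₂0 p u)))
                      (hK40 _ _ _ _)) (mul_nonneg (abs_nonneg _) (hσA0 u z'))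
          _ = ∑ u, K4 s p q u * (ϑ₂ s p * ϑ₂ s q * ϑ₂ s u * ϑ₂ p q * ϑ₂ p u * ϑ₂ q u) * ∑ z', |A u z'| * σA u z' := by
              rw [sum_comm]; exact sum_congr rfl fun u _ => by rw [mul_sum]
    _ ≤ ∑ p, ∑ q, ∑ u, K4 s p q u * (ϑ₂ s p * ϑ₂ s q * ϑ₂ s u * ϑ₂ p q * ϑ₂ p u * ϑ₂ q u) * αrσ := sum_le_sum fun p _ => sum_le_sum fun q _ =>
        sum_le_sum fun u _ =>
        mul_le_mul_of_nonneg_left (hAr u) (mul_nonneg (hK40 _ _ _ _) (hW0 p q u))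
    _ = (∑ p, ∑ q, ∑ u, K4 s p q u * (ϑ₂ s p * ϑ₂ s q * ϑ₂ s u * ϑ₂ p q * ϑ₂ p u * ϑ₂ q u)) * αrσ := by
        rw [sum_mul]; refine sum_congr rfl fun p _ => ?_; rw [sum_mul]; exact sum_congr rfl fun q _ => by rw [sum_mul]
    _ ≤ k4ϑ1 * αrσ := mul_le_mul_of_nonneg_right (hk4 s) hα0

/-- **`αk4m2`**: the `K4`-family mass with the fixed index in position 2 and partner weights,
`Σ_{p,q}ϑ₂(s,p)ϑ₂(s,q)ϑ₂(p,q)Σ_{z′}(Σ_u|A_{uz′}|K4)σ_{sz′} ≤ k4ϑ2·αrσ` from the full-graph letter of that role. [folklore] -/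
theorem k4_mass_2 (hK40 : ∀ a b c u, 0 ≤ K4 a b c u) (hϑ₂1 : ∀ x y, 1 ≤ ϑ₂ x y) (hσA0 : ∀ u z', 0 ≤ σA u z')
    (hσϑ : ∀ v u z', σ v z' ≤ ϑ₂ v u * σA u z') (hAr : ∀ u, ∑ z', |A u z'| * σA u z' ≤ αrσ) (hα0 : 0 ≤ αrσ)
    (hk4 : ∀ s, ∑ p, ∑ q, ∑ u, K4 p s q u * (ϑ₂ s p * ϑ₂ s q * ϑ₂ s u * ϑ₂ p q * ϑ₂ p u * ϑ₂ q u) ≤ k4ϑ2) (s : ι) :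
    ∑ p, ∑ q, (ϑ₂ s p * ϑ₂ s q * ϑ₂ p q) * ∑ z', (∑ u, |A u z'| * K4 p s q u) * σ s z' ≤ k4ϑ2 * αrσ := by
  have hϑ₂0 : ∀ x y, 0 ≤ ϑ₂ x y := fun x y => zero_le_one.trans (hϑ₂1 x y)
  have hW0 : ∀ p q u, 0 ≤ ϑ₂ s p * ϑ₂ s q * ϑ₂ s u * ϑ₂ p q * ϑ₂ p u * ϑ₂ q u := fun p q u =>
    mul_nonneg (mul_nonneg (mul_nonneg (mul_nonneg (mul_nonneg (hϑ₂0 s p) (hϑ₂0 s q)) (hϑ₂0 s u)) (hϑ₂0 p q)) (hϑ₂0 p u)) (hϑ₂0 q u)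
  calc ∑ p, ∑ q, (ϑ₂ s p * ϑ₂ s q * ϑ₂ p q) * ∑ z', (∑ u, |A u z'| * K4 p s q u) * σ s z'
      ≤ ∑ p, ∑ q, ∑ u, K4 p s q u * (ϑ₂ s p * ϑ₂ s q * ϑ₂ s u * ϑ₂ p q * ϑ₂ p u * ϑ₂ q u) * ∑ z', |A u z'| * σA u z' := by
        refine sum_le_sum fun p _ => sum_le_sum fun q _ => ?_
        rw [mul_sum]
        calc ∑ z', (ϑ₂ s p * ϑ₂ s q * ϑ₂ p q) * ((∑ u, |A u z'| * K4 p s q u) * σ s z')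
            ≤ ∑ z', ∑ u, K4 p s q u * (ϑ₂ s p * ϑ₂ s q * ϑ₂ s u * ϑ₂ p q * ϑ₂ p u * ϑ₂ q u) * (|A u z'| * σA u z') := by
              refine sum_le_sum fun z' _ => ?_
              rw [sum_mul, mul_sum]
              refine sum_le_sum fun u _ => ?_
              calc (ϑ₂ s p * ϑ₂ s q * ϑ₂ p q) * (|A u z'| * K4 p s q u * σ s z') ≤ (ϑ₂ s p * ϑ₂ s q * ϑ₂ p q) * (|A u z'| * K4 p s q u * (ϑ₂ s u *
        σA u z')) :=
                    mul_le_mul_of_nonneg_left (mul_le_mul_of_nonneg_left (hσϑ s u z') (mul_nonneg (abs_nonneg _) (hK40 _ _ _ _)))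
                      (mul_nonneg (mul_nonneg (hϑ₂0 s p) (hϑ₂0 s q)) (hϑ₂0 p q))
                _ = K4 p s q u * (ϑ₂ s p * ϑ₂ s q * ϑ₂ s u * ϑ₂ p q * 1 * 1) * (|A u z'| * σA u z') := by ring
                _ ≤ K4 p s q u * (ϑ₂ s p * ϑ₂ s q * ϑ₂ s u * ϑ₂ p q * ϑ₂ p u * ϑ₂ q u) * (|A u z'| * σA u z') :=
                    mul_le_mul_of_nonneg_right (mul_le_mul_of_nonneg_left (mul_le_mul (mul_le_mul_of_nonneg_left (hϑ₂1 p u)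
                      (mul_nonneg (mul_nonneg (mul_nonneg (hϑ₂0 s p) (hϑ₂0 s q)) (hϑ₂0 s u)) (hϑ₂0 p q))) (hϑ₂1 q u) zero_le_one
                      (mul_nonneg (mul_nonneg (mul_nonneg (mul_nonneg (hϑ₂0 s p) (hϑ₂0 s q)) (hϑ₂0 s u)) (hϑ₂0 p q)) (hϑ₂0 p u)))
                      (hK40 _ _ _ _)) (mul_nonneg (abs_nonneg _) (hσA0 u z'))
          _ = ∑ u, K4 p s q u * (ϑ₂ s p * ϑ₂ s q * ϑ₂ s u * ϑ₂ p q * ϑ₂ p u * ϑ₂ q u) * ∑ z', |A u z'| * σA u z' := by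
              rw [sum_comm]; exact sum_congr rfl fun u _ => by rw [mul_sum]
    _ ≤ ∑ p, ∑ q, ∑ u, K4 p s q u * (ϑ₂ s p * ϑ₂ s q * ϑ₂ s u * ϑ₂ p q * ϑ₂ p u * ϑ₂ q u) * αrσ := sum_le_sum fun p _ => sum_le_sum fun q _ =>
        sum_le_sum fun u _ =>
        mul_le_mul_of_nonneg_left (hAr u) (mul_nonneg (hK40 _ _ _ _) (hW0 p q u))
    _ = (∑ p, ∑ q, ∑ u, K4 p s q u * (ϑ₂ s p * ϑ₂ s q * ϑ₂ s u * ϑ₂ p q * ϑ₂ p u * ϑ₂ q u)) * αrσ := by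
        rw [sum_mul]; refine sum_congr rfl fun p _ => ?_; rw [sum_mul]; exact sum_congr rfl fun q _ => by rw [sum_mul]
    _ ≤ k4ϑ2 * αrσ := mul_le_mul_of_nonneg_right (hk4 s) hα0

/-- **`αk4m3`**: the `K4`-family mass with the fixed index in position 3 and partner weights,
`Σ_{p,q}ϑ₂(s,p)ϑ₂(s,q)ϑ₂(p,q)Σ_{z′}(Σ_u|A_{uz′}|K4)σ_{sz′} ≤ k4ϑ3·αrσ` from the full-graph letter of that role. [folklore] -/
theorem k4_mass_3 (hK40 : ∀ a b c u, 0 ≤ K4 a b c u) (hϑ₂1 : ∀ x y, 1 ≤ ϑ₂ x y) (hσA0 : ∀ u z', 0 ≤ σA u z')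
    (hσϑ : ∀ v u z', σ v z' ≤ ϑ₂ v u * σA u z') (hAr : ∀ u, ∑ z', |A u z'| * σA u z' ≤ αrσ) (hα0 : 0 ≤ αrσ)
    (hk4 : ∀ s, ∑ p, ∑ q, ∑ u, K4 p q s u * (ϑ₂ s p * ϑ₂ s q * ϑ₂ s u * ϑ₂ p q * ϑ₂ p u * ϑ₂ q u) ≤ k4ϑ3) (s : ι) :
    ∑ p, ∑ q, (ϑ₂ s p * ϑ₂ s q * ϑ₂ p q) * ∑ z', (∑ u, |A u z'| * K4 p q s u) * σ s z' ≤ k4ϑ3 * αrσ := by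
  have hϑ₂0 : ∀ x y, 0 ≤ ϑ₂ x y := fun x y => zero_le_one.trans (hϑ₂1 x y)
  have hW0 : ∀ p q u, 0 ≤ ϑ₂ s p * ϑ₂ s q * ϑ₂ s u * ϑ₂ p q * ϑ₂ p u * ϑ₂ q u := fun p q u =>
    mul_nonneg (mul_nonneg (mul_nonneg (mul_nonneg (mul_nonneg (hϑ₂0 s p) (hϑ₂0 s q)) (hϑ₂0 s u)) (hϑ₂0 p q)) (hϑ₂0 p u)) (hϑ₂0 q u)
  calc ∑ p, ∑ q, (ϑ₂ s p * ϑ₂ s q * ϑ₂ p q) * ∑ z', (∑ u, |A u z'| * K4 p q s u) * σ s z'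
      ≤ ∑ p, ∑ q, ∑ u, K4 p q s u * (ϑ₂ s p * ϑ₂ s q * ϑ₂ s u * ϑ₂ p q * ϑ₂ p u * ϑ₂ q u) * ∑ z', |A u z'| * σA u z' := by
        refine sum_le_sum fun p _ => sum_le_sum fun q _ => ?_
        rw [mul_sum]
        calc ∑ z', (ϑ₂ s p * ϑ₂ s q * ϑ₂ p q) * ((∑ u, |A u z'| * K4 p q s u) * σ s z')
            ≤ ∑ z', ∑ u, K4 p q s u * (ϑ₂ s p * ϑ₂ s q * ϑ₂ s u * ϑ₂ p q * ϑ₂ p u * ϑ₂ q u) * (|A u z'| * σA u z') := by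
              refine sum_le_sum fun z' _ => ?_
              rw [sum_mul, mul_sum]
              refine sum_le_sum fun u _ => ?_
              calc (ϑ₂ s p * ϑ₂ s q * ϑ₂ p q) * (|A u z'| * K4 p q s u * σ s z') ≤ (ϑ₂ s p * ϑ₂ s q * ϑ₂ p q) * (|A u z'| * K4 p q s u * (ϑ₂ s u *
        σA u z')) :=
                    mul_le_mul_of_nonneg_left (mul_le_mul_of_nonneg_left (hσϑ s u z') (mul_nonneg (abs_nonneg _) (hK40 _ _ _ _)))
                      (mul_nonneg (mul_nonneg (hϑ₂0 s p) (hϑ₂0 s q)) (hϑ₂0 p q))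
                _ = K4 p q s u * (ϑ₂ s p * ϑ₂ s q * ϑ₂ s u * ϑ₂ p q * 1 * 1) * (|A u z'| * σA u z') := by ring
                _ ≤ K4 p q s u * (ϑ₂ s p * ϑ₂ s q * ϑ₂ s u * ϑ₂ p q * ϑ₂ p u * ϑ₂ q u) * (|A u z'| * σA u z') :=
                    mul_le_mul_of_nonneg_right (mul_le_mul_of_nonneg_left (mul_le_mul (mul_le_mul_of_nonneg_left (hϑ₂1 p u)
                      (mul_nonneg (mul_nonneg (mul_nonneg (hϑ₂0 s p) (hϑ₂0 s q)) (hϑ₂0 s u)) (hϑ₂0 p q))) (hϑ₂1 q u) zero_le_one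
                      (mul_nonneg (mul_nonneg (mul_nonneg (mul_nonneg (hϑ₂0 s p) (hϑ₂0 s q)) (hϑ₂0 s u)) (hϑ₂0 p q)) (hϑ₂0 p u)))
                      (hK40 _ _ _ _)) (mul_nonneg (abs_nonneg _) (hσA0 u z'))
          _ = ∑ u, K4 p q s u * (ϑ₂ s p * ϑ₂ s q * ϑ₂ s u * ϑ₂ p q * ϑ₂ p u * ϑ₂ q u) * ∑ z', |A u z'| * σA u z' := by
              rw [sum_comm]; exact sum_congr rfl fun u _ => by rw [mul_sum]
    _ ≤ ∑ p, ∑ q, ∑ u, K4 p q s u * (ϑ₂ s p * ϑ₂ s q * ϑ₂ s u * ϑ₂ p q * ϑ₂ p u * ϑ₂ q u) * αrσ := sum_le_sum fun p _ => sum_le_sum fun q _ =>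
        sum_le_sum fun u _ =>
        mul_le_mul_of_nonneg_left (hAr u) (mul_nonneg (hK40 _ _ _ _) (hW0 p q u))
    _ = (∑ p, ∑ q, ∑ u, K4 p q s u * (ϑ₂ s p * ϑ₂ s q * ϑ₂ s u * ϑ₂ p q * ϑ₂ p u * ϑ₂ q u)) * αrσ := by
        rw [sum_mul]; refine sum_congr rfl fun p _ => ?_; rw [sum_mul]; exact sum_congr rfl fun q _ => by rw [sum_mul]
    _ ≤ k4ϑ3 * αrσ := mul_le_mul_of_nonneg_right (hk4 s) hα0

omit [Fintype κ] in
/-- **`αk4c`**: the `K4`-family column letter with internal weights, `Σ_{a,b,c}(Σ_u|A_{uz′}|K4_{abcu})σ_{az′}ϑ₂(a,b)ϑ₂(a,c)ϑ₂(b,c) ≤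
k4ϑ4·αcσ` from the full-graph fourth-index letter (`ϑ₂` symmetric, `≥ 1`). [folklore] -/
theorem k4_col_internal (hK40 : ∀ a b c u, 0 ≤ K4 a b c u) (hϑ₂1 : ∀ x y, 1 ≤ ϑ₂ x y) (hϑ₂symm : ∀ x y, ϑ₂ x y = ϑ₂ y x)
    (hσA0 : ∀ u z', 0 ≤ σA u z') (hσϑ : ∀ v u z', σ v z' ≤ ϑ₂ v u * σA u z') (hAc : ∀ z', ∑ u, |A u z'| * σA u z' ≤ αcσ)
    (hk4c : ∀ u, ∑ a, ∑ b, ∑ c, K4 a b c u * (ϑ₂ u a * ϑ₂ u b * ϑ₂ u c * ϑ₂ a b * ϑ₂ a c * ϑ₂ b c) ≤ k4ϑ4) (hk4c0 : 0 ≤ k4ϑ4) (z' : κ) :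
    ∑ a, ∑ b, ∑ c, (∑ u, |A u z'| * K4 a b c u) * (σ a z' * (ϑ₂ a b * ϑ₂ a c * ϑ₂ b c)) ≤ k4ϑ4 * αcσ := by
  have hϑ₂0 : ∀ x y, 0 ≤ ϑ₂ x y := fun x y => zero_le_one.trans (hϑ₂1 x y)
  have hI0 : ∀ a b c, 0 ≤ ϑ₂ a b * ϑ₂ a c * ϑ₂ b c := fun a b c => mul_nonneg (mul_nonneg (hϑ₂0 a b) (hϑ₂0 a c)) (hϑ₂0 b c)
  calc ∑ a, ∑ b, ∑ c, (∑ u, |A u z'| * K4 a b c u) * (σ a z' * (ϑ₂ a b * ϑ₂ a c * ϑ₂ b c))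
      ≤ ∑ a, ∑ b, ∑ c, ∑ u, |A u z'| * σA u z' * (K4 a b c u * (ϑ₂ u a * ϑ₂ u b * ϑ₂ u c * ϑ₂ a b * ϑ₂ a c * ϑ₂ b c)) := by
        refine sum_le_sum fun a _ => sum_le_sum fun b _ => sum_le_sum fun c _ => ?_
        rw [sum_mul]
        refine sum_le_sum fun u _ => ?_
        calc |A u z'| * K4 a b c u * (σ a z' * (ϑ₂ a b * ϑ₂ a c * ϑ₂ b c))
            ≤ |A u z'| * K4 a b c u * (ϑ₂ a u * σA u z' * (ϑ₂ a b * ϑ₂ a c * ϑ₂ b c)) :=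
              mul_le_mul_of_nonneg_left (mul_le_mul_of_nonneg_right (hσϑ a u z') (hI0 a b c)) (mul_nonneg (abs_nonneg _) (hK40 a b c u))
          _ = |A u z'| * σA u z' * (K4 a b c u * (ϑ₂ u a * 1 * 1 * ϑ₂ a b * ϑ₂ a c * ϑ₂ b c)) := by rw [hϑ₂symm a u]; ring
          _ ≤ |A u z'| * σA u z' * (K4 a b c u * (ϑ₂ u a * ϑ₂ u b * ϑ₂ u c * ϑ₂ a b * ϑ₂ a c * ϑ₂ b c)) :=
              mul_le_mul_of_nonneg_left (mul_le_mul_of_nonneg_left (mul_le_mul_of_nonneg_right (mul_le_mul_of_nonneg_right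
                (mul_le_mul_of_nonneg_right (mul_le_mul (mul_le_mul_of_nonneg_left (hϑ₂1 u b) (hϑ₂0 u a)) (hϑ₂1 u c) zero_le_one
                (mul_nonneg (hϑ₂0 u a) (hϑ₂0 u b))) (hϑ₂0 a b)) (hϑ₂0 a c)) (hϑ₂0 b c)) (hK40 a b c u))
                (mul_nonneg (abs_nonneg _) (hσA0 u z'))
    _ = ∑ a, ∑ b, ∑ u, ∑ c, |A u z'| * σA u z' * (K4 a b c u * (ϑ₂ u a * ϑ₂ u b * ϑ₂ u c * ϑ₂ a b * ϑ₂ a c * ϑ₂ b c)) :=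
        sum_congr rfl fun a _ => sum_congr rfl fun b _ => sum_comm
    _ = ∑ a, ∑ u, ∑ b, ∑ c, |A u z'| * σA u z' * (K4 a b c u * (ϑ₂ u a * ϑ₂ u b * ϑ₂ u c * ϑ₂ a b * ϑ₂ a c * ϑ₂ b c)) :=
        sum_congr rfl fun a _ => sum_comm
    _ = ∑ u, ∑ a, ∑ b, ∑ c, |A u z'| * σA u z' * (K4 a b c u * (ϑ₂ u a * ϑ₂ u b * ϑ₂ u c * ϑ₂ a b * ϑ₂ a c * ϑ₂ b c)) := sum_comm
    _ = ∑ u, |A u z'| * σA u z' * ∑ a, ∑ b, ∑ c, K4 a b c u * (ϑ₂ u a * ϑ₂ u b * ϑ₂ u c * ϑ₂ a b * ϑ₂ a c * ϑ₂ b c) :=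
        sum_congr rfl fun u _ => by
          rw [mul_sum]; refine sum_congr rfl fun a _ => ?_; rw [mul_sum]; exact sum_congr rfl fun b _ => by rw [mul_sum]
    _ ≤ ∑ u, |A u z'| * σA u z' * k4ϑ4 := sum_le_sum fun u _ => mul_le_mul_of_nonneg_left (hk4c u) (mul_nonneg (abs_nonneg _) (hσA0 u z'))
    _ = (∑ u, |A u z'| * σA u z') * k4ϑ4 := by rw [sum_mul]
    _ ≤ αcσ * k4ϑ4 := mul_le_mul_of_nonneg_right (hAc z') hk4c0
    _ = k4ϑ4 * αcσ := mul_comm _ _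

/-! ## Toy -/

/-- Toy (the transport in numbers): an intrinsic letter `2` and a factor letter `3` give the profile letter `6`. -/
example : (2 : ℝ) * 3 = 6 := by norm_num

end Summit.QuantumFields.BalabanUV.T4Continuum.NE7b.SupWeightedFamilyProfilesK4

end
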